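import Literature.AlgebraicGeometry.Frobenioids.ModelFrobenioidPreSteps
import Literature.AnabelianGeometry.EtaleTheta.Discharge.Sec5ModelCase
import Literature.AnabelianGeometry.EtaleTheta.Discharge.Sec5TransportsOfBiKummerData
import Literature.AnabelianGeometry.EtaleTheta.Discharge.Sec5TransportsHYddOfConnectedTemperoidStrv
import Literature.AnabelianGeometry.EtaleTheta.Discharge.Sec3TemperedFrobenioidNotGroupLike
import Literature.AnabelianGeometry.SemiGraphs.CosetCategoriesSlimTempered
import Literature.AlgebraicGeometry.Frobenioids.QuasiTemperoidConnectedPart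

/-!
# [EtTh] §5, Thm. 5.6/5.7: "Prop. 5.3 (vi) read at the pair" — the divisor-matching binder versus the transport equations (p.329 / PDF p.103)

Mochizuki, *The étale theta function …*, Publ. RIMS **45** (2009), proof of Thm. 5.6, p.329 (PDF p.103): "since `Ψ`
[essentially] preserves the divisor of zeroes and poles of `Θ̈` [cf. Proposition 5.3, (vi)], it follows [cf. the equivalences of
categories involving pre-steps of [FrdI], Definition 1.3, (iii), (d)] that there exist isomorphisms `γ₁ : S₁ ⥲ T₁`,
`γ₂ : S₂ ⥲ T₂`, `u ∈ O^×(T₂)` such that `γ₂ ∘ s^⊓ = t^⊓ ∘ γ₁`, `u ∘ γ₂ ∘ s^⊔ = t^⊔ ∘ γ₁`"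
[cite: MochizukiEtTh2009, Thm 5.6 proof p.329 (PDF p.103); Thm 5.7 p.329–330 (PDF pp.103–104)];
[FrdI] Thm. 5.2 (ii) [cite: MochizukiFrdI2008, Thm. 5.2(ii) p.101].

PROOF-ONLY (0 definitions, no new named fact).  abc-iut cell, layer L2, row ROWS #14 **R232** (abc-iut-L2-lead gen 4) «PROP 5.3
(vi) @A_N, e = 1 FORM» — the binder pair `hdivcap`/`hdivcup` of the Thm. 5.7 transport producers of the abc-iut-w5-d245 lineage
(`exists_capCupTransport_ofBiKummerData`, `exists_unit_transports_hYdd_ofConnectedTemperoidData(_strv)`) and the `∃ e` form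
`hdiv` of abc-iut-L2-d4's `Sec5Thm57.rootTransport_of` ("the reading of Prop. 5.3 (vi) at `A_N`").  For §5 data over a MODEL tempered
Frobenioid ([EtTh] Def. 3.6 (ii); `𝔉.pre = PreFrobenioidData.ofModel Φ B Div_B`, which the genuine data `ofBiKummerData` /
`ofConnectedTemperoidData` satisfy by `rfl`) this file records, kernel-checked:

* `div_transported_eq_of_eq_model` — the CONVERSE of the transport step: an equation `α⁻¹ ≫ Ψ(s) ≫ β = e ≫ s ≫ D` with `D` an
  automorphism of `B_N` forces `Div(α⁻¹ ≫ Ψ(s) ≫ β) = Div(e ≫ s)` ([FrdI] Thm. 5.2 (ii): isomorphisms have `deg_Fr = 1`, `Div = 0`).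
  Hence at every level of a transport family whose `hT`/`hT′` are known (e.g. abc-iut-f-121's `exists_unit_transport_twisted`,
  `e = 1`, `D_c = 1`) the "e = 1 form" binders hold OUTRIGHT (`div_eq_of_transport_refl_model`): they are not an independent input there.
* `hdiv_iff_exists_codTransport_model` — "Prop. 5.3 (vi) read at the pair" (`∃ e`, divisor matching) is EQUIVALENT to the
  transport-up-to-a-unit conclusion `∃ e D_c D_p, hT ∧ hT′ ∧ D_c⁻¹·D_p ∈ O^×(B_N)` (forward: abc-iut-L2-d4's
  `exists_codTransport_of_div_eq_model`; backward: the first item).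
* `exists_div_eq_refl_of_hdiv_model` — the `∃ e` form yields the `e = 1` form after RE-ANCHORING `α ↦ α ≪≫ e`
  (`Div(e⁻¹ ≫ e ≫ s) = Div(s)`); so "e = 1" costs nothing when the identification `Ψ(A_N) ⥲ A_N` is free.
* `exists_normalisedAnchors_of_hdiv_model` — from the `∃ e` form: NORMALISED ANCHORS `eA : Ψ(A_N) ⥲ A_N`, `eB : Ψ(B_N) ⥲ B_N`
  and a unit `u ∈ O^×(B_N)` with `eA⁻¹ ≫ Ψ(s^⊓_N) ≫ eB = s^⊓_N`, `eA⁻¹ ≫ Ψ(s^⊔_N) ≫ eB = s^⊔_N ≫ u` — exactly print's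
  `(γ₁, γ₂, u)` and exactly the inputs `hnum`/`hden` of abc-iut-f-121's `NthRoot.transportAt` / `exists_unit_transport_twisted`.

CENSUS CONSEQUENCE (for the Thm. 5.7 capstone list of abc-iut-L2-d4, item "Prop 5.3 (vi)@A_N e=1 form"): the ONE irreducible input
is the `∃ e` divisor matching at the BASE pair (where the anchors are produced); its derivation from the typed Prop. 5.3 (vi)
(`FrobenioidThetaDivisors.PreservesThetaDivisorOrbit`, over the stub data `DivisorTransportStub`/`DivisorPrimeData` at `A_⊚`) needs
[FrdI] Thm. 4.9's divisor clause for `Ψ` and the `A_⊚ ↔ A_N` divisor dictionary, neither of which the abstract §5 structure carries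
(GAP-LEDGER row of this seat).  HONEST FRAMING: kernel-checked implications between typed statements about the §5 data; nothing here
asserts a result of [EtTh] for an actual curve; typed ≠ discharged; no side is taken on [IUTchIII] Cor. 3.12.
-/

namespace Literature.AnabelianGeometry.EtaleTheta

open CategoryTheory Opposite Literature.AlgebraicGeometry.Frobenioids

universe w v u

namespace ThetaFrobenioid

variable {D : Type u} [Category.{v} D] {Φ B : Dᵒᵖ ⥤ CommMonCat.{w}} {DivB : B ⟶ monoidGp Φ}
  {𝔉 : ThetaFrobenioid.{w} (ModelFrobenioid Φ B DivB) D}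

section Model

variable (Ψ : ModelFrobenioid Φ B DivB ≌ ModelFrobenioid Φ B DivB)
  (α : Ψ.functor.obj 𝔉.AN ≅ 𝔉.AN) (β : Ψ.functor.obj 𝔉.BN ≅ 𝔉.BN)

/-- **Converse of the transport step** (model case): if `α⁻¹ ≫ Ψ(s) ≫ β = e ≫ s ≫ D` for an automorphism `D` of `B_N`, then
the zero divisors of `α⁻¹ ≫ Ψ(s) ≫ β` and `e ≫ s` agree — isomorphisms of a model Frobenioid have `deg_Fr = 1` and `Div = 0`
([FrdI] Thm. 5.2 (ii), `ModelFrobenioid.div_comp_of_isIso`).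
[cite: MochizukiEtTh2009, Thm 5.6 proof p.329 (PDF p.103)] -/
theorem div_transported_eq_of_eq_model (h𝔉 : 𝔉.pre = PreFrobenioidData.ofModel Φ B DivB)
    (hΦd : Objectwise (fun M _ => IsDivisorial M) Φ) {s : 𝔉.AN ⟶ 𝔉.BN} {e : 𝔉.AN ≅ 𝔉.AN} {Dc : Aut 𝔉.BN}
    (hT : α.inv ≫ Ψ.functor.map s ≫ β.hom = e.hom ≫ s ≫ Dc.hom) :
    𝔉.pre.div (α.inv ≫ Ψ.functor.map s ≫ β.hom) = 𝔉.pre.div (e.hom ≫ s) := by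
  rw [hT, h𝔉, PreFrobenioidData.ofModel_div, PreFrobenioidData.ofModel_div, ← Category.assoc]
  exact ModelFrobenioid.div_comp_of_isIso hΦd _ _

/-- The `e = 1`, "`D` an automorphism" instance: `α⁻¹ ≫ Ψ(s) ≫ β = s ≫ D` forces `Div(α⁻¹ ≫ Ψ(s) ≫ β) = Div(s)` — the shape
of the binders `hdivcap₁`/`hdivcup₁` of `exists_unit_transports_hYdd_ofConnectedTemperoidData(_strv)`, read off a level of a
transport family with `hT`/`hT′` (`e = 1`, `D_c = 1`, `D_p` a unit).  [cite: MochizukiEtTh2009, Thm 5.6 proof p.329 (PDF p.103)] -/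
theorem div_eq_of_transport_refl_model (h𝔉 : 𝔉.pre = PreFrobenioidData.ofModel Φ B DivB)
    (hΦd : Objectwise (fun M _ => IsDivisorial M) Φ) {s : 𝔉.AN ⟶ 𝔉.BN} {Dc : Aut 𝔉.BN}
    (hT : α.inv ≫ Ψ.functor.map s ≫ β.hom = s ≫ Dc.hom) :
    𝔉.pre.div (α.inv ≫ Ψ.functor.map s ≫ β.hom) = 𝔉.pre.div s := by
  have hT' : α.inv ≫ Ψ.functor.map s ≫ β.hom = (Iso.refl 𝔉.AN).hom ≫ s ≫ Dc.hom := by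
    rw [Iso.refl_hom, Category.id_comp]; exact hT
  rw [div_transported_eq_of_eq_model Ψ α β h𝔉 hΦd hT', Iso.refl_hom, Category.id_comp]

/-- **"Prop. 5.3 (vi) read at the pair" ⟺ transport up to a unit** (model case, base of FSM-type, `Ψ` preserving base-equivalent
pairs): the `∃ e` divisor-matching binder `hdiv` of abc-iut-L2-d4's `rootTransport_of` is EQUIVALENT to the existence of
`e, D_c, D_p` with `α⁻¹ ≫ Ψ(s^⊓_N) ≫ β = e ≫ s^⊓_N ≫ D_c`, `α⁻¹ ≫ Ψ(s^⊔_N) ≫ β = e ≫ s^⊔_N ≫ D_p`, `D_c⁻¹·D_p ∈ O^×(B_N)`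
(forward: `exists_codTransport_of_div_eq_model`, [FrdI] Thm. 5.2 (ii) + Thm. 3.4 (ii); backward: `div_transported_eq_of_eq_model`).
[cite: MochizukiEtTh2009, Thm 5.6 proof p.329 (PDF p.103); Thm 5.7 p.329–330 (PDF pp.103–104)] -/
theorem hdiv_iff_exists_codTransport_model (h𝔉 : 𝔉.pre = PreFrobenioidData.ofModel Φ B DivB)
    (h : ModelFrobenioid.Hypotheses Φ B) (hD : IsOfFSMType D)
    (hbe : ∀ ⦃A X : ModelFrobenioid Φ B DivB⦄ (φ ψ : A ⟶ X), 𝔉.pre.BaseEquivalent φ ψ →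
      𝔉.pre.BaseEquivalent (Ψ.functor.map φ) (Ψ.functor.map ψ)) :
    (∃ e : 𝔉.AN ≅ 𝔉.AN,
      𝔉.pre.div (α.inv ≫ Ψ.functor.map 𝔉.sCap ≫ β.hom) = 𝔉.pre.div (e.hom ≫ 𝔉.sCap) ∧
      𝔉.pre.div (α.inv ≫ Ψ.functor.map 𝔉.sCup ≫ β.hom) = 𝔉.pre.div (e.hom ≫ 𝔉.sCup)) ↔
    ∃ (e : 𝔉.AN ≅ 𝔉.AN) (Dc Dp : Aut 𝔉.BN),
      α.inv ≫ Ψ.functor.map 𝔉.sCap ≫ β.hom = e.hom ≫ 𝔉.sCap ≫ Dc.hom ∧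
      α.inv ≫ Ψ.functor.map 𝔉.sCup ≫ β.hom = e.hom ≫ 𝔉.sCup ≫ Dp.hom ∧
      Dc⁻¹ * Dp ∈ 𝔉.units 𝔉.BN := by
  constructor
  · rintro ⟨e, hcap, hcup⟩
    obtain ⟨Dc, Dp, hc, hp, hu⟩ := exists_codTransport_of_div_eq_model Ψ α β h𝔉 h hD hbe e hcap hcup
    exact ⟨e, Dc, Dp, hc, hp, hu⟩
  · rintro ⟨e, Dc, Dp, hc, hp, -⟩
    exact ⟨e, div_transported_eq_of_eq_model Ψ α β h𝔉 h.isDivisorial hc,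
      div_transported_eq_of_eq_model Ψ α β h𝔉 h.isDivisorial hp⟩

/-- **`e = 1` after re-anchoring** (model case): if `Div(α⁻¹ ≫ Ψ(s) ≫ β) = Div(e ≫ s)`, then for the identification
`α ≪≫ e : Ψ(A_N) ⥲ A_N` the zero divisor of the transported arrow is `Div(s)` on the nose
(`Div(e⁻¹ ≫ t) = Base(e⁻¹)^* Div(t)`, `Div(e ≫ s) = Base(e)^* Div(s)`, [FrdI] Thm. 5.2 (ii)).
[cite: MochizukiEtTh2009, Thm 5.6 proof p.329 (PDF p.103)] -/
theorem div_eq_refl_of_div_eq_trans_model (h𝔉 : 𝔉.pre = PreFrobenioidData.ofModel Φ B DivB)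
    (hΦd : Objectwise (fun M _ => IsDivisorial M) Φ) {s : 𝔉.AN ⟶ 𝔉.BN} {e : 𝔉.AN ≅ 𝔉.AN}
    (hdiv : 𝔉.pre.div (α.inv ≫ Ψ.functor.map s ≫ β.hom) = 𝔉.pre.div (e.hom ≫ s)) :
    𝔉.pre.div ((α ≪≫ e).inv ≫ Ψ.functor.map s ≫ β.hom) = 𝔉.pre.div s := by
  rw [h𝔉, PreFrobenioidData.ofModel_div, PreFrobenioidData.ofModel_div] at hdiv
  rw [h𝔉, PreFrobenioidData.ofModel_div, PreFrobenioidData.ofModel_div, Iso.trans_inv, Category.assoc,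
    ModelFrobenioid.div_comp_of_isIso' hΦd e.inv, hdiv, ModelFrobenioid.div_comp_of_isIso' hΦd e.hom,
    ← Literature.AlgebraicGeometry.Frobenioids.pull_comp, ← ModelFrobenioid.baseMap_comp, e.inv_hom_id,
    ModelFrobenioid.baseMap_id, Literature.AlgebraicGeometry.Frobenioids.pull_id]

/-- **The `∃ e` form yields the `e = 1` form after re-anchoring** (model case): from abc-iut-L2-d4's `hdiv` at `(α, β)` there is an
identification `α′ : Ψ(A_N) ⥲ A_N` (namely `α ≪≫ e`) at which BOTH divisor matchings hold with `e = 1` — the shape of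
`hdivcap₁`/`hdivcup₁` of `exists_unit_transports_hYdd_ofConnectedTemperoidData(_strv)`; `β` is unchanged.
[cite: MochizukiEtTh2009, Thm 5.6 proof p.329 (PDF p.103)] -/
theorem exists_div_eq_refl_of_hdiv_model (h𝔉 : 𝔉.pre = PreFrobenioidData.ofModel Φ B DivB)
    (hΦd : Objectwise (fun M _ => IsDivisorial M) Φ)
    (hdiv : ∃ e : 𝔉.AN ≅ 𝔉.AN,
      𝔉.pre.div (α.inv ≫ Ψ.functor.map 𝔉.sCap ≫ β.hom) = 𝔉.pre.div (e.hom ≫ 𝔉.sCap) ∧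
      𝔉.pre.div (α.inv ≫ Ψ.functor.map 𝔉.sCup ≫ β.hom) = 𝔉.pre.div (e.hom ≫ 𝔉.sCup)) :
    ∃ α' : Ψ.functor.obj 𝔉.AN ≅ 𝔉.AN,
      𝔉.pre.div (α'.inv ≫ Ψ.functor.map 𝔉.sCap ≫ β.hom) = 𝔉.pre.div 𝔉.sCap ∧
      𝔉.pre.div (α'.inv ≫ Ψ.functor.map 𝔉.sCup ≫ β.hom) = 𝔉.pre.div 𝔉.sCup := by
  obtain ⟨e, hcap, hcup⟩ := hdiv
  exact ⟨α ≪≫ e, div_eq_refl_of_div_eq_trans_model Ψ α β h𝔉 hΦd hcap,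
    div_eq_refl_of_div_eq_trans_model Ψ α β h𝔉 hΦd hcup⟩

/-- **Normalised anchors from "Prop. 5.3 (vi) read at the pair"** (model case; print's `γ₁, γ₂, u`, p.329 (PDF p.103)): from the
`∃ e` divisor matching at `(α, β)` there are identifications `eA : Ψ(A_N) ⥲ A_N`, `eB : Ψ(B_N) ⥲ B_N` and a UNIT `u ∈ O^×(B_N)`
with `eA⁻¹ ≫ Ψ(s^⊓_N) ≫ eB = s^⊓_N` and `eA⁻¹ ≫ Ψ(s^⊔_N) ≫ eB = s^⊔_N ≫ u` — `D_c = 1`, `e = 1` (namely `eA := α ≪≫ e`,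
`eB := β ≪≫ D_c⁻¹`, `u := D_c⁻¹·D_p`); these are exactly the inputs `hnum`/`hden` of abc-iut-f-121's `NthRoot.transportAt` /
`exists_unit_transport_twisted`.  Inputs as for `exists_codTransport_of_div_eq_model`: base of FSM-type ([FrdI] Thm. 3.4 (ii)),
"`Ψ` preserves base-equivalent pairs" (Thm. 3.4 (v)).  [cite: MochizukiEtTh2009, Thm 5.6 proof p.329 (PDF p.103); Thm 5.7 p.329–330 (PDF pp.103–104)] -/
theorem exists_normalisedAnchors_of_hdiv_model (h𝔉 : 𝔉.pre = PreFrobenioidData.ofModel Φ B DivB)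
    (h : ModelFrobenioid.Hypotheses Φ B) (hD : IsOfFSMType D)
    (hbe : ∀ ⦃A X : ModelFrobenioid Φ B DivB⦄ (φ ψ : A ⟶ X), 𝔉.pre.BaseEquivalent φ ψ →
      𝔉.pre.BaseEquivalent (Ψ.functor.map φ) (Ψ.functor.map ψ))
    (hdiv : ∃ e : 𝔉.AN ≅ 𝔉.AN,
      𝔉.pre.div (α.inv ≫ Ψ.functor.map 𝔉.sCap ≫ β.hom) = 𝔉.pre.div (e.hom ≫ 𝔉.sCap) ∧
      𝔉.pre.div (α.inv ≫ Ψ.functor.map 𝔉.sCup ≫ β.hom) = 𝔉.pre.div (e.hom ≫ 𝔉.sCup)) :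
    ∃ (eA : Ψ.functor.obj 𝔉.AN ≅ 𝔉.AN) (eB : Ψ.functor.obj 𝔉.BN ≅ 𝔉.BN) (u : Aut 𝔉.BN),
      u ∈ 𝔉.units 𝔉.BN ∧
      eA.inv ≫ Ψ.functor.map 𝔉.sCap ≫ eB.hom = 𝔉.sCap ∧
      eA.inv ≫ Ψ.functor.map 𝔉.sCup ≫ eB.hom = 𝔉.sCup ≫ u.hom := by
  obtain ⟨e, hcap, hcup⟩ := hdiv
  obtain ⟨Dc, Dp, hc, hp, hu⟩ := exists_codTransport_of_div_eq_model Ψ α β h𝔉 h hD hbe e hcap hcup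
  obtain ⟨hc', hp', hu'⟩ := 𝔉.capCupTransport_normalise hc hp hu
  refine ⟨α ≪≫ e, β ≪≫ Dc.symm, Dc⁻¹ * Dp, hu', ?_, ?_⟩
  · rw [Iso.trans_inv, Category.assoc, hc', e.inv_hom_id_assoc]
    show 𝔉.sCap ≫ 𝟙 _ = 𝔉.sCap
    rw [Category.comp_id]
  · rw [Iso.trans_inv, Category.assoc, hp', e.inv_hom_id_assoc]

/-- The same with "`Ψ` preserves base-equivalent pairs" DISCHARGED for a slim base of FSM-type, `Φ` non-dilating and `C` not of
group-like type (abc-iut-L2-d4's `baseEquivalent_map_of_model`, [FrdI] Thm. 3.4 (v) via [EtTh] Prop. 5.1 / Thm. 3.7 (i)).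
[cite: MochizukiEtTh2009, Thm 5.6 proof p.329 (PDF p.103); Thm 3.7 p.305 (PDF p.79)] -/
theorem exists_normalisedAnchors_of_hdiv_model_slim (h𝔉 : 𝔉.pre = PreFrobenioidData.ofModel Φ B DivB)
    (h : ModelFrobenioid.Hypotheses Φ B) (hD : IsOfFSMType D) (hslim : IsSlim D) (hnd : IsNonDilatingOn Φ)
    (hN : ∃ A : ModelFrobenioid Φ B DivB, ¬ (PreFrobenioidData.ofModel Φ B DivB).IsGroupLikeObj A)
    (hdiv : ∃ e : 𝔉.AN ≅ 𝔉.AN,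
      𝔉.pre.div (α.inv ≫ Ψ.functor.map 𝔉.sCap ≫ β.hom) = 𝔉.pre.div (e.hom ≫ 𝔉.sCap) ∧
      𝔉.pre.div (α.inv ≫ Ψ.functor.map 𝔉.sCup ≫ β.hom) = 𝔉.pre.div (e.hom ≫ 𝔉.sCup)) :
    ∃ (eA : Ψ.functor.obj 𝔉.AN ≅ 𝔉.AN) (eB : Ψ.functor.obj 𝔉.BN ≅ 𝔉.BN) (u : Aut 𝔉.BN),
      u ∈ 𝔉.units 𝔉.BN ∧
      eA.inv ≫ Ψ.functor.map 𝔉.sCap ≫ eB.hom = 𝔉.sCap ∧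
      eA.inv ≫ Ψ.functor.map 𝔉.sCup ≫ eB.hom = 𝔉.sCup ≫ u.hom :=
  exists_normalisedAnchors_of_hdiv_model Ψ α β h𝔉 h hD (baseEquivalent_map_of_model h𝔉 h hD hslim hnd hN Ψ) hdiv

end Model

/-! ### At the genuine §5 data `ofConnectedTemperoidData` over `B^temp(Π^tp_X)⁰` -/

section ConnectedTemperoidData

open Literature.AnabelianGeometry.SemiGraphs Literature.AnabelianGeometry.SemiGraphs.GaloisObjects FrobenioidCyclotomicRigidity

universe u₀ v₀ w₀

variable {K : Type u₀} [Field K] {X : SemiGraphs.TemperedArithmeticGroup.{u₀} K} {D₀ : Type u₀} [Category.{v₀} D₀]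
  {V : FrdIMonoidStub.{w₀}} {T₀ : RealifiedDivisorMonoids (D₀ := D₀) V}
  {VD : FrdICatStub.{u₀ + 1, u₀, w₀} (ConnectedPart (BTemp X.Pi))}
  {tf : TemperedFrobenioid T₀ (ConnectedPart (BTemp X.Pi)) VD} {hZ : tf.monoidType = MonoidType.Z}
  {hP : ∀ A : (ConnectedPart (BTemp X.Pi))ᵒᵖ, IsPerfect (tf.Φ.carrier A)}
  {NH : Subgroup (Field.absoluteGaloisGroup K) → tf.category → ℕ+ → Prop} {A₀ : tf.category}
  {hA₀ : PreFrobenioid.IsFrobeniusTrivial tf.toElem A₀} {hA₀' : SemiGraphs.IsGaloisObj A₀.base.obj}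
  {lv N : ℕ+} {T : ThetaEnvData.{max u₀ w₀} N}
  {pullFrac : ∀ {A A' : (BiKummerSetting.mkOfConnectedTemperoid X tf hZ hP NH A₀ hA₀ hA₀').C} (_ : A' ⟶ A),
    (BiKummerSetting.mkOfConnectedTemperoid X tf hZ hP NH A₀ hA₀ hA₀').biratUnits A →
      (BiKummerSetting.mkOfConnectedTemperoid X tf hZ hP NH A₀ hA₀ hA₀').biratUnits A'}
  {θ : (BiKummerSetting.mkOfConnectedTemperoid X tf hZ hP NH A₀ hA₀ hA₀').biratUnits
    (BiKummerSetting.mkOfConnectedTemperoid X tf hZ hP NH A₀ hA₀ hA₀').Aodot}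
  {Bl : (BiKummerSetting.mkOfConnectedTemperoid X tf hZ hP NH A₀ hA₀ hA₀').C}
  {Pl : (BiKummerSetting.mkOfConnectedTemperoid X tf hZ hP NH A₀ hA₀ hA₀').FractionPair θ Bl}
  {Rl : (BiKummerSetting.mkOfConnectedTemperoid X tf hZ hP NH A₀ hA₀ hA₀').NthRoot θ Pl lv pullFrac}
  (h : ModelFrobenioid.Hypotheses tf.divisorMonoid tf.ratFnFunctor)
  (Q : FrobenioidTheta.ThetaSubquotientStub.{w₀} (ConnectedPart (BTemp X.Pi))) (odd_l : Odd (lv : ℕ))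
  (R : (BiKummerSetting.mkOfConnectedTemperoid X tf hZ hP NH A₀ hA₀ hA₀').NthRoot Rl.root Rl.pair N pullFrac)
  (ιX : T.PiX ≃ₜ* X.Pi) (K' : Type w₀) [Field K'] (constEmb : K'ˣ →* tf.biratUnitsModel R.BN)
  (constEmb_injective : Function.Injective constEmb)
  (hinvc : ∀ g : Aut R.AN.base,
    pull tf.divisorMonoid g.hom (ModelFrobenioid.div R.pair.num) = ModelFrobenioid.div R.pair.num)
  (hinvp : ∀ y : T.PiX, y ∈ T.PiYdd →
    pull tf.divisorMonoid ((BiKummerSetting.mkOfConnectedTemperoid X tf hZ hP NH A₀ hA₀ hA₀').galoisSurj R.AN.base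
      R.αData.isGalois (ιX y)).hom (ModelFrobenioid.div R.pair.den) = ModelFrobenioid.div R.pair.den)
  (Ψ : (BiKummerSetting.mkOfConnectedTemperoid X tf hZ hP NH A₀ hA₀ hA₀').C ≌
    (BiKummerSetting.mkOfConnectedTemperoid X tf hZ hP NH A₀ hA₀ hA₀').C)
  (α : Ψ.functor.obj (ofConnectedTemperoidData h Q odd_l R ιX K' constEmb constEmb_injective hinvc hinvp).AN ≅
    (ofConnectedTemperoidData h Q odd_l R ιX K' constEmb constEmb_injective hinvc hinvp).AN)
  (β : Ψ.functor.obj (ofConnectedTemperoidData h Q odd_l R ιX K' constEmb constEmb_injective hinvc hinvp).BN ≅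
    (ofConnectedTemperoidData h Q odd_l R ιX K' constEmb constEmb_injective hinvc hinvp).BN)

/-- **The `e = 1`-form binders at the genuine data FROM the transport equations**: at
`𝔉 := ofConnectedTemperoidData …`, equations `α⁻¹ ≫ Ψ(s^⊓_N) ≫ β = e ≫ s^⊓_N ≫ D_c`, `α⁻¹ ≫ Ψ(s^⊔_N) ≫ β = e ≫ s^⊔_N ≫ D_p`
(the per-level output `hT`/`hT′` of a transport family, e.g. abc-iut-f-121's `exists_unit_transport_twisted`) give abc-iut-L2-d4's
divisor matching `hdiv` at `(α, β)` for THIS `e` — no Prop. 5.3 (vi) input at such a level.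
[cite: MochizukiEtTh2009, Thm 5.6 proof p.329 (PDF p.103); Thm 5.7 p.329–330 (PDF pp.103–104)] -/
theorem hdiv_of_transport_ofConnectedTemperoidData
    {e : (ofConnectedTemperoidData h Q odd_l R ιX K' constEmb constEmb_injective hinvc hinvp).AN ≅
      (ofConnectedTemperoidData h Q odd_l R ιX K' constEmb constEmb_injective hinvc hinvp).AN}
    {Dc Dp : Aut (ofConnectedTemperoidData h Q odd_l R ιX K' constEmb constEmb_injective hinvc hinvp).BN}
    (hT : α.inv ≫ Ψ.functor.map (ofConnectedTemperoidData h Q odd_l R ιX K' constEmb constEmb_injective hinvc hinvp).sCap ≫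
        β.hom =
      e.hom ≫ (ofConnectedTemperoidData h Q odd_l R ιX K' constEmb constEmb_injective hinvc hinvp).sCap ≫ Dc.hom)
    (hT' : α.inv ≫ Ψ.functor.map (ofConnectedTemperoidData h Q odd_l R ιX K' constEmb constEmb_injective hinvc hinvp).sCup ≫
        β.hom =
      e.hom ≫ (ofConnectedTemperoidData h Q odd_l R ιX K' constEmb constEmb_injective hinvc hinvp).sCup ≫ Dp.hom) :
    (ofConnectedTemperoidData h Q odd_l R ιX K' constEmb constEmb_injective hinvc hinvp).pre.div
        (α.inv ≫ Ψ.functor.map (ofConnectedTemperoidData h Q odd_l R ιX K' constEmb constEmb_injective hinvc hinvp).sCap ≫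
          β.hom) =
      (ofConnectedTemperoidData h Q odd_l R ιX K' constEmb constEmb_injective hinvc hinvp).pre.div
        (e.hom ≫ (ofConnectedTemperoidData h Q odd_l R ιX K' constEmb constEmb_injective hinvc hinvp).sCap) ∧
    (ofConnectedTemperoidData h Q odd_l R ιX K' constEmb constEmb_injective hinvc hinvp).pre.div
        (α.inv ≫ Ψ.functor.map (ofConnectedTemperoidData h Q odd_l R ιX K' constEmb constEmb_injective hinvc hinvp).sCup ≫
          β.hom) =
      (ofConnectedTemperoidData h Q odd_l R ιX K' constEmb constEmb_injective hinvc hinvp).pre.div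
        (e.hom ≫ (ofConnectedTemperoidData h Q odd_l R ιX K' constEmb constEmb_injective hinvc hinvp).sCup) :=
  ⟨div_transported_eq_of_eq_model Ψ α β rfl h.isDivisorial hT, div_transported_eq_of_eq_model Ψ α β rfl h.isDivisorial hT'⟩

/-- **The binders `hdivcap₁`/`hdivcup₁` of `exists_unit_transports_hYdd_ofConnectedTemperoidData(_strv)` FROM `e = 1`
transport equations** `α⁻¹ ≫ Ψ(s^⊓_N) ≫ β = s^⊓_N ≫ D_c`, `α⁻¹ ≫ Ψ(s^⊔_N) ≫ β = s^⊔_N ≫ D_p` (any automorphisms `D_c, D_p` of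
`B_N`).  [cite: MochizukiEtTh2009, Thm 5.6 proof p.329 (PDF p.103)] -/
theorem hdivcapcup_of_transport_refl_ofConnectedTemperoidData
    {Dc Dp : Aut (ofConnectedTemperoidData h Q odd_l R ιX K' constEmb constEmb_injective hinvc hinvp).BN}
    (hT : α.inv ≫ Ψ.functor.map (ofConnectedTemperoidData h Q odd_l R ιX K' constEmb constEmb_injective hinvc hinvp).sCap ≫
        β.hom =
      (ofConnectedTemperoidData h Q odd_l R ιX K' constEmb constEmb_injective hinvc hinvp).sCap ≫ Dc.hom)
    (hT' : α.inv ≫ Ψ.functor.map (ofConnectedTemperoidData h Q odd_l R ιX K' constEmb constEmb_injective hinvc hinvp).sCup ≫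
        β.hom =
      (ofConnectedTemperoidData h Q odd_l R ιX K' constEmb constEmb_injective hinvc hinvp).sCup ≫ Dp.hom) :
    (ofConnectedTemperoidData h Q odd_l R ιX K' constEmb constEmb_injective hinvc hinvp).pre.div
        (α.inv ≫ Ψ.functor.map (ofConnectedTemperoidData h Q odd_l R ιX K' constEmb constEmb_injective hinvc hinvp).sCap ≫
          β.hom) =
      (ofConnectedTemperoidData h Q odd_l R ιX K' constEmb constEmb_injective hinvc hinvp).pre.div
        (ofConnectedTemperoidData h Q odd_l R ιX K' constEmb constEmb_injective hinvc hinvp).sCap ∧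
    (ofConnectedTemperoidData h Q odd_l R ιX K' constEmb constEmb_injective hinvc hinvp).pre.div
        (α.inv ≫ Ψ.functor.map (ofConnectedTemperoidData h Q odd_l R ιX K' constEmb constEmb_injective hinvc hinvp).sCup ≫
          β.hom) =
      (ofConnectedTemperoidData h Q odd_l R ιX K' constEmb constEmb_injective hinvc hinvp).pre.div
        (ofConnectedTemperoidData h Q odd_l R ιX K' constEmb constEmb_injective hinvc hinvp).sCup :=
  ⟨div_eq_of_transport_refl_model Ψ α β rfl h.isDivisorial hT, div_eq_of_transport_refl_model Ψ α β rfl h.isDivisorial hT'⟩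

/-- **Thm. 5.10 (ii) / Thm. 5.7: the FIVE transport binders at the genuine data with NO divisor binder left** — the capstone
`exists_unit_transports_hYdd_ofConnectedTemperoidData_strv` (p437125) with `hdivcap₁`/`hdivcup₁` PRODUCED from `e = 1` transport
equations at `(α, β)` (`hdivcapcup_of_transport_refl_ofConnectedTemperoidData`) and with the base hypotheses DISCHARGED:
`B^temp(Π^tp_X)⁰` is of FSM-type (`QuasiTemperoid.BTempConnected.connectedPart_isOfFSMType`, [FrdII] Ex. 1.3) and slim
(abc-iut-L2-d4's `TemperedArithmeticGroup.isSlim_connectedPart`), and some object is not group-like (abc-iut-w4-d008's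
`TemperedFrobenioid.exists_not_isGroupLikeObj_ofModel`).  Remaining inputs: `Φ` non-dilating (instance-level), the
transport equations, Prop. 2.4 (`hP24`).  [cite: MochizukiEtTh2009, Thm 5.10 (ii) p.334 (PDF p.108); Thm 5.7 p.329–330 (PDF pp.103–104)] -/
theorem exists_unit_transports_hYdd_ofConnectedTemperoidData_of_transport (hnd : IsNonDilatingOn tf.divisorMonoid)
    {Dc₀ Dp₀ : Aut (ofConnectedTemperoidData h Q odd_l R ιX K' constEmb constEmb_injective hinvc hinvp).BN}
    (hT₀ : α.inv ≫ Ψ.functor.map (ofConnectedTemperoidData h Q odd_l R ιX K' constEmb constEmb_injective hinvc hinvp).sCap ≫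
        β.hom =
      (ofConnectedTemperoidData h Q odd_l R ιX K' constEmb constEmb_injective hinvc hinvp).sCap ≫ Dc₀.hom)
    (hT₀' : α.inv ≫ Ψ.functor.map (ofConnectedTemperoidData h Q odd_l R ιX K' constEmb constEmb_injective hinvc hinvp).sCup ≫
        β.hom =
      (ofConnectedTemperoidData h Q odd_l R ιX K' constEmb constEmb_injective hinvc hinvp).sCup ≫ Dp₀.hom)
    (hP24 : ∀ γ : T.PiX ≃ₜ* T.PiX, T.PiYdd.map γ.toMulEquiv.toMonoidHom = T.PiYdd) :
    ∃ θA : Aut R.AN.base ≃* Aut R.AN.base,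
      ∃ e ∈ (ofConnectedTemperoidData h Q odd_l R ιX K' constEmb constEmb_injective hinvc hinvp).units
          (ofConnectedTemperoidData h Q odd_l R ιX K' constEmb constEmb_injective hinvc hinvp).AN,
        ∃ Dc Dp : Aut (ofConnectedTemperoidData h Q odd_l R ιX K' constEmb constEmb_injective hinvc hinvp).BN,
          α.inv ≫ Ψ.functor.map (ofConnectedTemperoidData h Q odd_l R ιX K' constEmb constEmb_injective hinvc hinvp).sCap ≫
              (β ≪≫ Dc.symm).hom =
            e.hom ≫ (ofConnectedTemperoidData h Q odd_l R ιX K' constEmb constEmb_injective hinvc hinvp).sCap ≫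
              (1 : Aut (ofConnectedTemperoidData h Q odd_l R ιX K' constEmb constEmb_injective hinvc hinvp).BN).hom ∧
          α.inv ≫ Ψ.functor.map (ofConnectedTemperoidData h Q odd_l R ιX K' constEmb constEmb_injective hinvc hinvp).sCup ≫
              (β ≪≫ Dc.symm).hom =
            e.hom ≫ (ofConnectedTemperoidData h Q odd_l R ιX K' constEmb constEmb_injective hinvc hinvp).sCup ≫ Dp.hom ∧
          Dp ∈ (ofConnectedTemperoidData h Q odd_l R ιX K' constEmb constEmb_injective hinvc hinvp).units
            (ofConnectedTemperoidData h Q odd_l R ιX K' constEmb constEmb_injective hinvc hinvp).BN ∧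
          (ofConnectedTemperoidData h Q odd_l R ιX K' constEmb constEmb_injective hinvc hinvp).StrvTransport Ψ α e
            (((ofConnectedTemperoidData h Q odd_l R ιX K' constEmb constEmb_injective hinvc hinvp).autBaseIsoAB.symm.trans θA).trans
              (ofConnectedTemperoidData h Q odd_l R ιX K' constEmb constEmb_injective hinvc hinvp).autBaseIsoAB) ∧
          (ofConnectedTemperoidData h Q odd_l R ιX K' constEmb constEmb_injective hinvc hinvp).HB.map
              ((((ofConnectedTemperoidData h Q odd_l R ιX K' constEmb constEmb_injective hinvc hinvp).autBaseIsoAB.symm.trans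
                  θA).trans
                (ofConnectedTemperoidData h Q odd_l R ιX K' constEmb constEmb_injective hinvc hinvp).autBaseIsoAB).toMonoidHom) =
            (ofConnectedTemperoidData h Q odd_l R ιX K' constEmb constEmb_injective hinvc hinvp).HB := by
  obtain ⟨hcap, hcup⟩ := hdivcapcup_of_transport_refl_ofConnectedTemperoidData h Q odd_l R ιX K' constEmb constEmb_injective
    hinvc hinvp Ψ α β hT₀ hT₀'
  exact exists_unit_transports_hYdd_ofConnectedTemperoidData_strv h Q odd_l R ιX K' constEmb constEmb_injective hinvc hinvp
    QuasiTemperoid.BTempConnected.connectedPart_isOfFSMType (SemiGraphs.TemperedArithmeticGroup.isSlim_connectedPart X) hnd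
    tf.exists_not_isGroupLikeObj_ofModel Ψ α β hcap hcup hP24

end ConnectedTemperoidData

end ThetaFrobenioid

end Literature.AnabelianGeometry.EtaleTheta
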